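import Literature.MathematicalPhysics.QuantumFieldTheory.Balaban1983to89.Node00.CriticalOnFibreTangent
import Literature.MathematicalPhysics.QuantumFieldTheory.Balaban1983to89.B10Eq68TorusRegularity

/-!
# NODE 00 — THE FIRST VARIATION OF THE WILSON ACTION (5) IS THE PAIRING WITH THE COVARIANT CO-DIVERGENCE `D^{η*}_U ∂U` OF [6] (1.2) ∕ [15] (2):
# `d∕dt A(γ_t)∣_{t₀} = −(1∕N)·Σ_b Re Tr( γ′_b·U_b⋆ · η(D^{η*}_U ∂U)(b) )` — the lattice Yang–Mills first variation in the tree's (2)-current letters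

Cell `pub-ymgap`, seat `pub-ymgap-dag-n07-e` generation 14 (R141 (C), DAG node N07 = [15]; MODULE 35f; INBOX INTENT-35f).  NEW leaf; CONSUMED BY NAME: this seat's g8
`Node00.WilsonActionFirstVariation` (`hasDerivAt_wilsonAction4`, `hasDerivAt_coe_plaqHol`, `star_deriv_mul_add_eq_zero`), lit-balaban's `B10Eq68TorusRegularity`
(`covDivT`, `covDerivT`, `plaqFT`: [6] (1.1)–(1.2) on the torus = the letters of [15] (2)'s second clause and of n01-b's `Node00.InUkClassB11`), `B10Eq27TorusAxialLog`
(`holT`, `unitsField`, `toUField`), `B7Eq78Linearization.conjR`.  `--kind proof --supports stmt-QuantumFields-20541` (K0⁷; count-neutral).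

WHY.  Modules 35c–35e (this seat) turn the tree's curve-form criticality into print's TANGENT form `d∕dt A(U·exp(tX))∣₀ = 0` on the kernel of the linearised averaging.
Print reads the left side through the current: [15] p. 300 ∕ (143) and [6] (1.2) «(D^{η*}_U ∂U)_μ(x) = Σ_{ν<μ}(D^{η*}_{U,ν}F_{νμ})(x) − Σ_{ν>μ}(D^{η*}_{U,ν}F_{μν})(x)»,
(1.1) «(D^{η*}_{U,ν}F)(x) = η⁻¹(R(U(x, x − ηe_ν))F(x − ηe_ν) − F(x))»; [15] (2)'s second clause bounds exactly this quantity.  This file proves the lattice identity behind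
that reading: g8's four-term Leibniz sum, regrouped plaquette by plaquette into bond terms by trace cyclicity and the tangent condition `Y⋆U + U⋆Y = 0`, IS the pairing
of the left-trivialised velocity `Z_b = Y_b U_b⋆` with `η·(D^{η*}_U ∂U)(b)`.  With 35c–35e: a critical configuration (either reading) satisfies
«`Σ_b Re Tr(Z_b·(D^{η*}_U∂U)(b)) = 0` for every admissible direction» — the weak lattice Yang–Mills equation in the letters of (2).

CONTENTS.  §0 sum bookkeeping (site lemmas BY NAME: `Site.shift_comm`, `Site.shift_unshift`, `Site.unshift_shift`); §1 dictionary (`conjR_inv_unitsField_toUField`, ★ `plaqFT_unitsField_toUField_eq_prod`, `smul_covDerivT`); §2 ★ `trace_fourTerm_eq`;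
§3–§4 `smul_covDivT_eq`, ★★ `sum_trace_fourTerm_eq_sum_covDivT`, ★★★ `hasDerivAt_wilsonAction4_covDivT` (every curve, every `η ≠ 0`), `…_expChart_covDivT` (the ray of 35a).

HONEST FRAMING: a lattice identity (finite sums, trace cyclicity); nothing of [15]'s or [6]'s estimates; no claim about minimisers; V16 stub 1 ∕ K0⁷ NOT closed; N07 NOT
discharged (5∕27); one finite T⁴ programme at fixed ε — NOT continuum ∕ ℝ⁴ ∕ OS ∕ mass gap ∕ Clay.  No `sorry`, no `def`. -/

noncomputable section

namespace Literature.MathematicalPhysics.QuantumFieldTheory.Balaban1983to89.Node00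

open Filter Topology
open T4Continuum (T4Family)
open B10Eq27TorusAxialLog (holT holT_nil holT_cons_true holT_cons_false toUField unitsField)
open B10Eq68TorusRegularity (covDivT covDerivT plaqFT)
open B7Eq78Linearization (conjR)
open B7Prop1Explicit (plaqWord)
open T4AdjointCovarianceUnitary (lieSU)
open scoped Matrix.Norms.L2Operator

/-! ## §0  Torus site bookkeeping -/

section Sites

variable {P : Params} {j : ℕ}

/-- The shift by `e_μ` is a bijection of the torus sites. [cite: Balaban1987RG1, (0.1) p.251 (bookkeeping)] -/
theorem sum_site_shift {α : Type*} [AddCommMonoid α] (μ : Fin P.d) (f : Site P j → α) :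
    ∑ x : Site P j, f (x.shift μ) = ∑ x : Site P j, f x :=
  Equiv.sum_comp (⟨fun x => x.shift μ, fun x => x.unshift μ, fun x => Site.unshift_shift x μ, fun x => Site.shift_unshift x μ⟩ :
    Site P j ≃ Site P j) f

/-- A sum over the positively oriented bonds is the sum over base points and directions. [folklore] -/
private theorem sum_bond_eq_sum_site {α : Type*} [AddCommMonoid α] (f : PBond P j → α) :
    ∑ b : PBond P j, f b = ∑ x : Site P j, ∑ μ : Fin P.d, f ⟨x, μ⟩ := by
  rw [← Fintype.sum_prod_type']
  exact (Equiv.sum_comp (⟨fun p => ⟨p.1, p.2⟩, fun b => (b.src, b.dir), fun _ => rfl, fun _ => rfl⟩ :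
    Site P j × Fin P.d ≃ PBond P j) f).symm

/-- A sum over the positively oriented plaquettes `⟨x; μ < ν⟩` is the sum over base points and ordered pairs `μ < ν`. [cite: Balaban1985Averaging, (5) p.18 (bookkeeping)] -/
theorem sum_plaq_eq_sum_site {α : Type*} [AddCommMonoid α] (g : Plaq P j → α) :
    ∑ p : Plaq P j, g p = ∑ x : Site P j, ∑ μ : Fin P.d, ∑ ν : Fin P.d, if h : μ < ν then g ⟨x, μ, ν, h⟩ else 0 := by
  classical
  set F : Site P j × Fin P.d × Fin P.d → α := fun a => if h : a.2.1 < a.2.2 then g ⟨a.1, a.2.1, a.2.2, h⟩ else 0 with hFdef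
  let e : {t : Site P j × Fin P.d × Fin P.d // t.2.1 < t.2.2} ≃ Plaq P j :=
    ⟨fun t => ⟨t.1.1, t.1.2.1, t.1.2.2, t.2⟩, fun p => ⟨(p.src, p.μ, p.ν), p.hμν⟩, fun _ => rfl, fun _ => rfl⟩
  have h1 : ∑ p : Plaq P j, g p = ∑ t : {t : Site P j × Fin P.d × Fin P.d // t.2.1 < t.2.2}, F t.1 := by
    rw [← Equiv.sum_comp e]
    refine Fintype.sum_congr _ _ fun t => ?_
    simp only [hFdef, dif_pos t.2]
    rfl
  have h2 : ∑ t : {t : Site P j × Fin P.d × Fin P.d // t.2.1 < t.2.2}, F t.1 = ∑ a, F a := by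
    rw [← Finset.sum_subtype (Finset.univ.filter fun t : Site P j × Fin P.d × Fin P.d => t.2.1 < t.2.2) (fun t => by simp) F,
      Finset.sum_filter]
    refine Finset.sum_congr rfl fun a _ => ?_
    by_cases h : a.2.1 < a.2.2
    · rw [if_pos h]
    · rw [if_neg h, hFdef]
      simp only [dif_neg h]
  rw [h1, h2, Fintype.sum_prod_type, Finset.sum_congr rfl fun x _ => Fintype.sum_prod_type _]

/-- `Σ_{ν < μ}` as a guarded sum over all directions. [cite: Balaban1985RegularSpaces, (1.2) p.76 (bookkeeping)] -/
theorem sum_Iio_eq_ite {α : Type*} [AddCommMonoid α] (μ : Fin P.d) (f : Fin P.d → α) :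
    ∑ ν ∈ Finset.Iio μ, f ν = ∑ ν : Fin P.d, if ν < μ then f ν else 0 := by
  rw [← Finset.sum_filter, Finset.filter_gt_eq_Iio]

/-- `Σ_{ν > μ}` as a guarded sum over all directions. [cite: Balaban1985RegularSpaces, (1.2) p.76 (bookkeeping)] -/
theorem sum_Ioi_eq_ite {α : Type*} [AddCommMonoid α] (μ : Fin P.d) (f : Fin P.d → α) :
    ∑ ν ∈ Finset.Ioi μ, f ν = ∑ ν : Fin P.d, if μ < ν then f ν else 0 := by
  rw [← Finset.sum_filter, Finset.filter_lt_eq_Ioi]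

end Sites

/-! ## §1  Dictionary: the `GL(N)`-reading of an `SU(N)` configuration — bond matrices, transports, plaquette fields, the current -/

section Dictionary

variable {P : Params} {j : ℕ} {N : ℕ}

/-- `R(V_b⁻¹)M = U_b⋆·M·U_b` (print's transport `R(U(x, x − e_ν))` of [6] (1.1), `R(X)Y = XYX⁻¹`; g2's `val_inv_unitsField_toUField`). [cite: Balaban1985RegularSpaces, (1.1) p.76] -/
theorem conjR_inv_unitsField_toUField (U : GaugeField P j (SU N)) (b : PBond P j) (M : Matrix (Fin N) (Fin N) ℂ) :
    conjR (unitsField (toUField U) b)⁻¹ M = star (U b : Matrix (Fin N) (Fin N) ℂ) * M * (U b : Matrix (Fin N) (Fin N) ℂ) := by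
  unfold conjR
  rw [inv_inv, val_inv_unitsField_toUField]
  rfl

/-- ★ **THE PLAQUETTE FIELD OF THE `GL`-READING AS A PRODUCT OF BOND MATRICES**, for EVERY ordered pair of directions (the word `(+e_μ, +e_ν, −e_μ, −e_ν)` from `x`;
g2's `plaqFT_unitsField_toUField` followed by the `SU(N)` transport along the plaquette word): `F_{μν}(x) = U⟨x,μ⟩·U⟨x+e_μ,ν⟩·U⟨x+e_ν,μ⟩⋆·U⟨x,ν⟩⋆`.
[cite: Balaban1985RegularSpaces, (1.2) p.76; Balaban1985Averaging, (9) p.19] -/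
theorem plaqFT_unitsField_toUField_eq_prod (U : GaugeField P j (SU N)) (μ ν : Fin P.d) (x : Site P j) :
    plaqFT (unitsField (toUField U)) μ ν x =
      (U ⟨x, μ⟩ : Matrix (Fin N) (Fin N) ℂ) * (U ⟨x.shift μ, ν⟩ : Matrix (Fin N) (Fin N) ℂ) *
        star (U ⟨x.shift ν, μ⟩ : Matrix (Fin N) (Fin N) ℂ) * star (U ⟨x, ν⟩ : Matrix (Fin N) (Fin N) ℂ) := by
  have h1 : ((x.shift μ).shift ν).unshift μ = x.shift ν := by rw [Site.shift_comm, Site.unshift_shift]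
  have h2 : (x.shift ν).unshift ν = x := Site.unshift_shift x ν
  rw [plaqFT_unitsField_toUField]
  simp only [plaqWord, holT_cons_true, holT_cons_false, holT_nil, mul_one, h1, h2, Submonoid.coe_mul]
  show (U ⟨x, μ⟩ : Matrix (Fin N) (Fin N) ℂ) * ((U ⟨x.shift μ, ν⟩ : Matrix (Fin N) (Fin N) ℂ) *
      (star (U ⟨x.shift ν, μ⟩ : Matrix (Fin N) (Fin N) ℂ) * star (U ⟨x, ν⟩ : Matrix (Fin N) (Fin N) ℂ))) = _
  noncomm_ring

/-- One transported difference of [6] (1.1) with the `η⁻¹` cleared: `η • (D^{η*}_{V,ν}F)(x) = R(V(x−e_ν,ν)⁻¹)F(x − e_ν) − F(x)`. [cite: Balaban1985RegularSpaces, (1.1) p.76] -/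
theorem smul_covDerivT {η : ℝ} (hη : η ≠ 0) (U : GaugeField P j (SU N)) (ν : Fin P.d) (F : Site P j → Matrix (Fin N) (Fin N) ℂ) (x : Site P j) :
    η • covDerivT η (unitsField (toUField U)) ν F x =
      star (U ⟨x.unshift ν, ν⟩ : Matrix (Fin N) (Fin N) ℂ) * F (x.unshift ν) * (U ⟨x.unshift ν, ν⟩ : Matrix (Fin N) (Fin N) ℂ) - F x := by
  unfold covDerivT
  rw [smul_smul, mul_inv_cancel₀ hη, one_smul, conjR_inv_unitsField_toUField]

end Dictionary

/-! ## §2  Per plaquette: the trace of the four-term Leibniz sum, regrouped by bonds -/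

section PerPlaquette

variable {N : ℕ}

/-- ★ **THE TRACE OF g8's FOUR-TERM SUM, REGROUPED**: for unitary bond matrices `A, B, C, D` (`F = ABC⋆D⋆`) and velocities `Y₁, …, Y₄` at the four edges satisfying the
tangent condition at the two BACKWARD edges (`Y⋆U + U⋆Y = 0` at `C` and `D`), with the LEFT-trivialised directions `Z_E = Y_E·E⋆`:
`Tr(Y₁BC⋆D⋆ + AY₂C⋆D⋆ + ABY₃⋆D⋆ + ABC⋆Y₄⋆) = Tr(Z_A·F) + Tr(Z_B·A⋆FA) − Tr(Z_C·D⋆FD) − Tr(Z_D·F)` — trace cyclicity. [cite: Balaban1985Variational, (5) p.278; Balaban1985RegularSpaces, (1.1)–(1.2) p.76 (bookkeeping)] -/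
theorem trace_fourTerm_eq {A B C D Y₁ Y₂ Y₃ Y₄ : Matrix (Fin N) (Fin N) ℂ}
    (hA : star A * A = 1) (hB : star B * B = 1) (hC : C * star C = 1) (hD : D * star D = 1) (hD' : star D * D = 1)
    (h₃ : star Y₃ * C + star C * Y₃ = 0) (h₄ : star Y₄ * D + star D * Y₄ = 0) :
    Matrix.trace (Y₁ * B * star C * star D + A * Y₂ * star C * star D + A * B * star Y₃ * star D + A * B * star C * star Y₄) =
      Matrix.trace (Y₁ * star A * (A * B * star C * star D)) + Matrix.trace (Y₂ * star B * (star A * (A * B * star C * star D) * A))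
        - Matrix.trace (Y₃ * star C * (star D * (A * B * star C * star D) * D)) - Matrix.trace (Y₄ * star D * (A * B * star C * star D)) := by
  -- the tangent conditions give `Y₃⋆ = −C⋆Y₃C⋆`, `Y₄⋆ = −D⋆Y₄D⋆`
  have h₃' : star Y₃ = -(star C * Y₃ * star C) := by
    have h : (star Y₃ * C + star C * Y₃) * star C = 0 := by rw [h₃, zero_mul]
    rw [add_mul, mul_assoc, hC, mul_one] at h
    exact eq_neg_of_add_eq_zero_left h
  have h₄' : star Y₄ = -(star D * Y₄ * star D) := by
    have h : (star Y₄ * D + star D * Y₄) * star D = 0 := by rw [h₄, zero_mul]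
    rw [add_mul, mul_assoc, hD, mul_one] at h
    exact eq_neg_of_add_eq_zero_left h
  have t1 : Matrix.trace (Y₁ * B * star C * star D) = Matrix.trace (Y₁ * star A * (A * B * star C * star D)) := by
    rw [show Y₁ * star A * (A * B * star C * star D) = Y₁ * (star A * A) * B * star C * star D by noncomm_ring, hA, mul_one]
  have t2 : Matrix.trace (A * Y₂ * star C * star D) = Matrix.trace (Y₂ * star B * (star A * (A * B * star C * star D) * A)) := by
    rw [show Y₂ * star B * (star A * (A * B * star C * star D) * A) = Y₂ * (star B * ((star A * A) * B)) * (star C * star D * A) by noncomm_ring,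
      hA, one_mul, hB, mul_one, show A * Y₂ * star C * star D = A * (Y₂ * (star C * star D)) by noncomm_ring, Matrix.trace_mul_comm,
      show Y₂ * (star C * star D) * A = Y₂ * (star C * star D * A) by noncomm_ring]
  have t3 : Matrix.trace (A * B * star Y₃ * star D) = -Matrix.trace (Y₃ * star C * (star D * (A * B * star C * star D) * D)) := by
    rw [h₃', show A * B * -(star C * Y₃ * star C) * star D = -((A * B * star C) * (Y₃ * star C * star D)) by noncomm_ring, Matrix.trace_neg,
      Matrix.trace_mul_comm, show star D * (A * B * star C * star D) * D = star D * A * B * star C * (star D * D) by noncomm_ring, hD', mul_one,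
      show Y₃ * star C * star D * (A * B * star C) = Y₃ * star C * (star D * A * B * star C) by noncomm_ring]
  have t4 : Matrix.trace (A * B * star C * star Y₄) = -Matrix.trace (Y₄ * star D * (A * B * star C * star D)) := by
    rw [h₄', show A * B * star C * -(star D * Y₄ * star D) = -((A * B * star C * star D) * (Y₄ * star D)) by noncomm_ring, Matrix.trace_neg,
      Matrix.trace_mul_comm]
  rw [Matrix.trace_add, Matrix.trace_add, Matrix.trace_add, t1, t2, t3, t4]
  ring

end PerPlaquette

/-! ## §3  Regrouping the four plaquette families by bonds -/

section Regroup

variable {P : Params} {j : ℕ}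

/-- Renaming∕swapping the two direction sums: `Σ_μ Σ_ν [μ<ν] T x μ ν = Σ_a Σ_ν [ν<a] T x ν a`. [cite: Balaban1985RegularSpaces, (1.2) p.76 (bookkeeping)] -/
theorem sum_dir_swap {α : Type*} [AddCommMonoid α] (T : Fin P.d → Fin P.d → α) :
    (∑ μ : Fin P.d, ∑ ν : Fin P.d, if μ < ν then T μ ν else 0) = ∑ a : Fin P.d, ∑ ν : Fin P.d, if ν < a then T ν a else 0 :=
  Finset.sum_comm

/-- `if c then a − b else 0 = (if c then a else 0) − (if c then b else 0)`. [cite: Balaban1985RegularSpaces, (1.2) p.76 (bookkeeping)] -/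
theorem ite_sub_else_zero {α : Type*} [AddCommGroup α] (c : Prop) [Decidable c] (a b : α) :
    (if c then a - b else 0) = (if c then a else 0) - (if c then b else 0) := by
  split_ifs <;> simp

/-- The same swap under a site sum. [cite: Balaban1985RegularSpaces, (1.2) p.76 (bookkeeping)] -/
theorem sum_dir_swap_site {α : Type*} [AddCommMonoid α] (T : Site P j → Fin P.d → Fin P.d → α) :
    (∑ x : Site P j, ∑ μ : Fin P.d, ∑ ν : Fin P.d, if μ < ν then T x μ ν else 0)
      = ∑ x : Site P j, ∑ a : Fin P.d, ∑ ν : Fin P.d, if ν < a then T x ν a else 0 :=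
  Finset.sum_congr rfl fun x _ => sum_dir_swap (T x)

/-- Moving an `x − e_ν` substitution out of a triple sum: `Σ_x Σ_a Σ_ν H (x − e_ν) a ν = Σ_x Σ_a Σ_ν H x a ν`. [cite: Balaban1987RG1, (0.1) p.251 (bookkeeping)] -/
theorem sum_site_unshift_inner {α : Type*} [AddCommMonoid α] (H : Site P j → Fin P.d → Fin P.d → α) :
    (∑ x : Site P j, ∑ a : Fin P.d, ∑ ν : Fin P.d, H (x.unshift ν) a ν) = ∑ x : Site P j, ∑ a : Fin P.d, ∑ ν : Fin P.d, H x a ν := by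
  rw [Finset.sum_comm]
  conv_rhs => rw [Finset.sum_comm]
  refine Finset.sum_congr rfl fun a _ => ?_
  rw [Finset.sum_comm]
  conv_rhs => rw [Finset.sum_comm]
  refine Finset.sum_congr rfl fun ν _ => ?_
  have h := sum_site_shift (P := P) (j := j) ν (fun x => H (x.unshift ν) a ν)
  simp only [Site.unshift_shift] at h
  exact h.symm

end Regroup

/-! ## §4  The first variation of (5) as the pairing with `η·D^{η*}_U ∂U` -/

section FirstVariationCoDiv

variable {P : Params} {j : ℕ} {N : ℕ}

/-- `η • (D^{η*}_U ∂U)(b)` written out for `b = ⟨x, μ⟩` (η-free; `η ≠ 0`): `Σ_{ν<μ}[U⟨x−ν,ν⟩⋆F_{νμ}(x−ν)U⟨x−ν,ν⟩ − F_{νμ}(x)] − Σ_{ν>μ}[U⟨x−ν,ν⟩⋆F_{μν}(x−ν)U⟨x−ν,ν⟩ − F_{μν}(x)]`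
with the sums over ALL directions guarded by `ν < μ` ∕ `μ < ν`. [cite: Balaban1985RegularSpaces, (1.1)–(1.2) p.76; Balaban1985Variational, (2) p.278] -/
theorem smul_covDivT_eq {η : ℝ} (hη : η ≠ 0) (U : GaugeField P j (SU N)) (μ : Fin P.d) (x : Site P j) :
    η • covDivT η (unitsField (toUField U)) μ x =
      (∑ ν : Fin P.d, if ν < μ then
          star (U ⟨x.unshift ν, ν⟩ : Matrix (Fin N) (Fin N) ℂ) * plaqFT (unitsField (toUField U)) ν μ (x.unshift ν) * (U ⟨x.unshift ν, ν⟩ : Matrix (Fin N) (Fin N) ℂ)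
            - plaqFT (unitsField (toUField U)) ν μ x else 0)
      - ∑ ν : Fin P.d, if μ < ν then
          star (U ⟨x.unshift ν, ν⟩ : Matrix (Fin N) (Fin N) ℂ) * plaqFT (unitsField (toUField U)) μ ν (x.unshift ν) * (U ⟨x.unshift ν, ν⟩ : Matrix (Fin N) (Fin N) ℂ)
            - plaqFT (unitsField (toUField U)) μ ν x else 0 := by
  unfold covDivT
  rw [smul_sub, Finset.smul_sum, Finset.smul_sum, sum_Iio_eq_ite, sum_Ioi_eq_ite]
  congr 1
  · refine Finset.sum_congr rfl fun ν _ => ?_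
    split_ifs
    · exact smul_covDerivT hη U ν _ x
    · rfl
  · refine Finset.sum_congr rfl fun ν _ => ?_
    split_ifs
    · exact smul_covDerivT hη U ν _ x
    · rfl

/-- ★★ **THE REGROUPED IDENTITY**: for a configuration `U` and a velocity field `Y` satisfying the tangent condition at every bond, the sum over plaquettes of the traces
of the four-term Leibniz sums equals the sum over bonds of `Tr(Y_b U_b⋆ · η(D^{η*}_U∂U)(b))`. [cite: Balaban1985Variational, (5) p.278; Balaban1985RegularSpaces, (1.1)–(1.2) p.76] -/
theorem sum_trace_fourTerm_eq_sum_covDivT {η : ℝ} (hη : η ≠ 0) (U : GaugeField P j (SU N)) (Y : PBond P j → Matrix (Fin N) (Fin N) ℂ)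
    (hY : ∀ b, star (Y b) * ((U b : SU N) : Matrix (Fin N) (Fin N) ℂ) + star ((U b : SU N) : Matrix (Fin N) (Fin N) ℂ) * Y b = 0) :
    ∑ p : Plaq P j, Matrix.trace
        (Y ⟨p.src, p.μ⟩ * (U ⟨p.src.shift p.μ, p.ν⟩ : Matrix (Fin N) (Fin N) ℂ) * star (U ⟨p.src.shift p.ν, p.μ⟩ : Matrix (Fin N) (Fin N) ℂ)
            * star (U ⟨p.src, p.ν⟩ : Matrix (Fin N) (Fin N) ℂ)
          + (U ⟨p.src, p.μ⟩ : Matrix (Fin N) (Fin N) ℂ) * Y ⟨p.src.shift p.μ, p.ν⟩ * star (U ⟨p.src.shift p.ν, p.μ⟩ : Matrix (Fin N) (Fin N) ℂ)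
            * star (U ⟨p.src, p.ν⟩ : Matrix (Fin N) (Fin N) ℂ)
          + (U ⟨p.src, p.μ⟩ : Matrix (Fin N) (Fin N) ℂ) * (U ⟨p.src.shift p.μ, p.ν⟩ : Matrix (Fin N) (Fin N) ℂ) * star (Y ⟨p.src.shift p.ν, p.μ⟩)
            * star (U ⟨p.src, p.ν⟩ : Matrix (Fin N) (Fin N) ℂ)
          + (U ⟨p.src, p.μ⟩ : Matrix (Fin N) (Fin N) ℂ) * (U ⟨p.src.shift p.μ, p.ν⟩ : Matrix (Fin N) (Fin N) ℂ)
            * star (U ⟨p.src.shift p.ν, p.μ⟩ : Matrix (Fin N) (Fin N) ℂ) * star (Y ⟨p.src, p.ν⟩))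
      = ∑ b : PBond P j, Matrix.trace (Y b * star ((U b : SU N) : Matrix (Fin N) (Fin N) ℂ) * (η • covDivT η (unitsField (toUField U)) b.dir b.src)) := by
  -- abbreviations
  set Zf : PBond P j → Matrix (Fin N) (Fin N) ℂ := fun b => Y b * star ((U b : SU N) : Matrix (Fin N) (Fin N) ℂ) with hZf
  set Ad : PBond P j → Matrix (Fin N) (Fin N) ℂ → Matrix (Fin N) (Fin N) ℂ :=
    fun b M => star ((U b : SU N) : Matrix (Fin N) (Fin N) ℂ) * M * ((U b : SU N) : Matrix (Fin N) (Fin N) ℂ) with hAd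
  set TA : Site P j → Fin P.d → Fin P.d → ℂ := fun x μ ν => Matrix.trace (Zf ⟨x, μ⟩ * plaqFT (unitsField (toUField U)) μ ν x) with hTA
  set TD : Site P j → Fin P.d → Fin P.d → ℂ := fun x μ ν => Matrix.trace (Zf ⟨x, ν⟩ * plaqFT (unitsField (toUField U)) μ ν x) with hTD
  set TB : Site P j → Fin P.d → Fin P.d → ℂ := fun x μ ν => Matrix.trace (Zf ⟨x.shift μ, ν⟩ * Ad ⟨x, μ⟩ (plaqFT (unitsField (toUField U)) μ ν x)) with hTB
  set TC : Site P j → Fin P.d → Fin P.d → ℂ := fun x μ ν => Matrix.trace (Zf ⟨x.shift ν, μ⟩ * Ad ⟨x, ν⟩ (plaqFT (unitsField (toUField U)) μ ν x)) with hTC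
  have huS : ∀ b : PBond P j, star ((U b : SU N) : Matrix (Fin N) (Fin N) ℂ) * (U b : Matrix (Fin N) (Fin N) ℂ) = 1 :=
    fun b => Unitary.star_mul_self_of_mem (Matrix.specialUnitaryGroup_le_unitaryGroup (U b).2)
  have huS' : ∀ b : PBond P j, ((U b : SU N) : Matrix (Fin N) (Fin N) ℂ) * star (U b : Matrix (Fin N) (Fin N) ℂ) = 1 :=
    fun b => Unitary.mul_star_self_of_mem (Matrix.specialUnitaryGroup_le_unitaryGroup (U b).2)
  -- Step A: per plaquette
  have hp : ∀ p : Plaq P j, Matrix.trace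
        (Y ⟨p.src, p.μ⟩ * (U ⟨p.src.shift p.μ, p.ν⟩ : Matrix (Fin N) (Fin N) ℂ) * star (U ⟨p.src.shift p.ν, p.μ⟩ : Matrix (Fin N) (Fin N) ℂ)
            * star (U ⟨p.src, p.ν⟩ : Matrix (Fin N) (Fin N) ℂ)
          + (U ⟨p.src, p.μ⟩ : Matrix (Fin N) (Fin N) ℂ) * Y ⟨p.src.shift p.μ, p.ν⟩ * star (U ⟨p.src.shift p.ν, p.μ⟩ : Matrix (Fin N) (Fin N) ℂ)
            * star (U ⟨p.src, p.ν⟩ : Matrix (Fin N) (Fin N) ℂ)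
          + (U ⟨p.src, p.μ⟩ : Matrix (Fin N) (Fin N) ℂ) * (U ⟨p.src.shift p.μ, p.ν⟩ : Matrix (Fin N) (Fin N) ℂ) * star (Y ⟨p.src.shift p.ν, p.μ⟩)
            * star (U ⟨p.src, p.ν⟩ : Matrix (Fin N) (Fin N) ℂ)
          + (U ⟨p.src, p.μ⟩ : Matrix (Fin N) (Fin N) ℂ) * (U ⟨p.src.shift p.μ, p.ν⟩ : Matrix (Fin N) (Fin N) ℂ)
            * star (U ⟨p.src.shift p.ν, p.μ⟩ : Matrix (Fin N) (Fin N) ℂ) * star (Y ⟨p.src, p.ν⟩))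
        = TA p.src p.μ p.ν + TB p.src p.μ p.ν - TC p.src p.μ p.ν - TD p.src p.μ p.ν := by
    intro p
    simp only [hTA, hTB, hTC, hTD, hZf, hAd, plaqFT_unitsField_toUField_eq_prod]
    exact trace_fourTerm_eq (huS _) (huS _) (huS' _) (huS' _) (huS _) (hY _) (hY _)
  rw [Finset.sum_congr rfl fun p _ => hp p]
  -- Step B: split the plaquette sum into the four families, as guarded triple sums
  rw [sum_plaq_eq_sum_site]
  simp only [dite_eq_ite]
  -- Step C: the bond side
  have hb : ∀ b : PBond P j, Matrix.trace (Y b * star ((U b : SU N) : Matrix (Fin N) (Fin N) ℂ) * (η • covDivT η (unitsField (toUField U)) b.dir b.src)) =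
      (∑ ν : Fin P.d, if ν < b.dir then Matrix.trace (Zf b * Ad ⟨b.src.unshift ν, ν⟩ (plaqFT (unitsField (toUField U)) ν b.dir (b.src.unshift ν))) - TD b.src ν b.dir else 0)
        - ∑ ν : Fin P.d, if b.dir < ν then Matrix.trace (Zf b * Ad ⟨b.src.unshift ν, ν⟩ (plaqFT (unitsField (toUField U)) b.dir ν (b.src.unshift ν))) - TA b.src b.dir ν else 0 := by
    intro b
    rw [smul_covDivT_eq hη U b.dir b.src, mul_sub, Finset.mul_sum, Finset.mul_sum, Matrix.trace_sub, Matrix.trace_sum, Matrix.trace_sum]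
    congr 1
    · refine Finset.sum_congr rfl fun ν _ => ?_
      split_ifs
      · simp only [hTD, hZf, hAd, mul_sub, Matrix.trace_sub]
      · simp
    · refine Finset.sum_congr rfl fun ν _ => ?_
      split_ifs
      · simp only [hTA, hZf, hAd, mul_sub, Matrix.trace_sub]
      · simp
  rw [Finset.sum_congr rfl fun b _ => hb b, sum_bond_eq_sum_site]
  -- Step D: the two `x − e_ν` families are the `TB`∕`TC` families after the substitution `x ↦ x + e_ν`
  have hB : (∑ x : Site P j, ∑ a : Fin P.d, ∑ ν : Fin P.d,
      if ν < a then Matrix.trace (Zf ⟨x, a⟩ * Ad ⟨x.unshift ν, ν⟩ (plaqFT (unitsField (toUField U)) ν a (x.unshift ν))) else 0)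
      = ∑ x : Site P j, ∑ a : Fin P.d, ∑ ν : Fin P.d, if ν < a then TB x ν a else 0 := by
    have h := sum_site_unshift_inner (P := P) (j := j) (fun y a ν => if ν < a then TB y ν a else (0 : ℂ))
    rw [← h]
    refine Finset.sum_congr rfl fun x _ => Finset.sum_congr rfl fun a _ => Finset.sum_congr rfl fun ν _ => ?_
    simp only [hTB, Site.shift_unshift]
  have hC : (∑ x : Site P j, ∑ μ : Fin P.d, ∑ ν : Fin P.d,
      if μ < ν then Matrix.trace (Zf ⟨x, μ⟩ * Ad ⟨x.unshift ν, ν⟩ (plaqFT (unitsField (toUField U)) μ ν (x.unshift ν))) else 0)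
      = ∑ x : Site P j, ∑ μ : Fin P.d, ∑ ν : Fin P.d, if μ < ν then TC x μ ν else 0 := by
    have h := sum_site_unshift_inner (P := P) (j := j) (fun y μ ν => if μ < ν then TC y μ ν else (0 : ℂ))
    rw [← h]
    refine Finset.sum_congr rfl fun x _ => Finset.sum_congr rfl fun μ _ => Finset.sum_congr rfl fun ν _ => ?_
    simp only [hTC, Site.shift_unshift]
  -- assemble: split sums of sums∕differences and compare family by family
  have hsplitL : (∑ x : Site P j, ∑ μ : Fin P.d, ∑ ν : Fin P.d, if μ < ν then TA x μ ν + TB x μ ν - TC x μ ν - TD x μ ν else 0)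
      = (∑ x : Site P j, ∑ μ : Fin P.d, ∑ ν : Fin P.d, if μ < ν then TA x μ ν else 0)
        + (∑ x : Site P j, ∑ μ : Fin P.d, ∑ ν : Fin P.d, if μ < ν then TB x μ ν else 0)
        - (∑ x : Site P j, ∑ μ : Fin P.d, ∑ ν : Fin P.d, if μ < ν then TC x μ ν else 0)
        - (∑ x : Site P j, ∑ μ : Fin P.d, ∑ ν : Fin P.d, if μ < ν then TD x μ ν else 0) := by
    simp only [← Finset.sum_add_distrib, ← Finset.sum_sub_distrib]
    refine Finset.sum_congr rfl fun x _ => Finset.sum_congr rfl fun μ _ => Finset.sum_congr rfl fun ν _ => ?_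
    split_ifs <;> ring
  have hsplitR : (∑ x : Site P j, ∑ μ : Fin P.d,
      ((∑ ν : Fin P.d, if ν < μ then Matrix.trace (Zf ⟨x, μ⟩ * Ad ⟨x.unshift ν, ν⟩ (plaqFT (unitsField (toUField U)) ν μ (x.unshift ν))) - TD x ν μ else 0)
        - ∑ ν : Fin P.d, if μ < ν then Matrix.trace (Zf ⟨x, μ⟩ * Ad ⟨x.unshift ν, ν⟩ (plaqFT (unitsField (toUField U)) μ ν (x.unshift ν))) - TA x μ ν else 0))
      = (∑ x : Site P j, ∑ a : Fin P.d, ∑ ν : Fin P.d,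
          if ν < a then Matrix.trace (Zf ⟨x, a⟩ * Ad ⟨x.unshift ν, ν⟩ (plaqFT (unitsField (toUField U)) ν a (x.unshift ν))) else 0)
        - (∑ x : Site P j, ∑ a : Fin P.d, ∑ ν : Fin P.d, if ν < a then TD x ν a else 0)
        - (∑ x : Site P j, ∑ μ : Fin P.d, ∑ ν : Fin P.d,
          if μ < ν then Matrix.trace (Zf ⟨x, μ⟩ * Ad ⟨x.unshift ν, ν⟩ (plaqFT (unitsField (toUField U)) μ ν (x.unshift ν))) else 0)
        + (∑ x : Site P j, ∑ μ : Fin P.d, ∑ ν : Fin P.d, if μ < ν then TA x μ ν else 0) := by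
    simp only [ite_sub_else_zero, Finset.sum_sub_distrib]
    ring
  rw [hsplitL, hsplitR, hB, hC, ← sum_dir_swap_site TB, ← sum_dir_swap_site TD]
  ring

end FirstVariationCoDiv

section Main

variable {P : Params} {j : ℕ} {N : ℕ} [NeZero N]

/-- ★★★ **THE FIRST VARIATION OF THE WILSON ACTION (5) IS THE PAIRING WITH `η·D^{η*}_U ∂U`** ([6] (1.1)–(1.2), the letters of [15] (2)'s second clause): along every curve
`γ` of `SU(N)` configurations with bond-wise matrix velocities `Y` at `t₀`, for every `η ≠ 0`,
`d∕dt A(γ_t)∣_{t₀} = −(1∕N)·Σ_b Re Tr( Y_b·U_b⋆ · η·(D^{η*}_U ∂U)(b) )`, `U = γ(t₀)` read in `GL(N)` through `unitsField ∘ toUField` (the reading of n01-b's `InUkClassB11`).  With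
`Z_b = Y_b U_b⋆ ∈ 𝔰𝔲(N)` this is the lattice Yang–Mills first-variation formula; with 35c–35e, a critical configuration of (5) on `𝔅_k(V)` satisfies
`Σ_b Re Tr(Z_b·(D^{η*}_U∂U)(b)) = 0` for every admissible (kernel) direction. [cite: Balaban1985Variational, (2),(5) p.278, (141) p.299, p.300; Balaban1985RegularSpaces, (1.1)–(1.2) p.76] -/
theorem hasDerivAt_wilsonAction4_covDivT {γ : ℝ → GaugeField P j (SU N)} {Y : PBond P j → Matrix (Fin N) (Fin N) ℂ} {t₀ : ℝ}
    (hγ : ∀ b, HasDerivAt (fun t => ((γ t b : SU N) : Matrix (Fin N) (Fin N) ℂ)) (Y b) t₀) {η : ℝ} (hη : η ≠ 0) :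
    HasDerivAt (fun t => wilsonAction4 (γ t))
      (-((∑ b : PBond P j, (Matrix.trace (Y b * star ((γ t₀ b : SU N) : Matrix (Fin N) (Fin N) ℂ) *
          (η • covDivT η (unitsField (toUField (γ t₀))) b.dir b.src))).re) / (Fintype.card (Fin N) : ℝ))) t₀ := by
  have hA := hasDerivAt_wilsonAction4 hγ (fun p => hasDerivAt_coe_plaqHol hγ p)
  refine hA.congr_deriv ?_
  have key := sum_trace_fourTerm_eq_sum_covDivT hη (γ t₀) Y (fun b => star_deriv_mul_add_eq_zero hγ b)
  have hre := congrArg Complex.re key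
  simp only [Complex.re_sum] at hre
  simp only [Matrix.traceLinearMap_apply]
  rw [← hre, Finset.sum_div, ← Finset.sum_neg_distrib]

/-- ★★★ **THE SAME ALONG THE EXPONENTIAL RAY** `t ↦ U·exp(tX)` of 35a (bond-wise velocity `U_b X_b`, left-trivialised direction `U_b X_b U_b⋆`):
`d∕dt A(U·exp(tX))∣₀ = −(1∕N)·Σ_b Re Tr( U_b X_b U_b⋆ · η·(D^{η*}_U ∂U)(b) )`. [cite: Balaban1985Variational, (2),(5) p.278, (82)–(83) p.290; Balaban1985RegularSpaces, (1.1)–(1.2) p.76] -/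
theorem hasDerivAt_wilsonAction4_expChart_covDivT (U : GaugeField P j (SU N)) (X : PBond P j → lieSU (Fin N)) {η : ℝ} (hη : η ≠ 0) :
    HasDerivAt (fun t : ℝ => wilsonAction4 (expChart U (t • X)))
      (-((∑ b : PBond P j, (Matrix.trace ((U b : Matrix (Fin N) (Fin N) ℂ) * (X b : Matrix (Fin N) (Fin N) ℂ) * star (U b : Matrix (Fin N) (Fin N) ℂ) *
          (η • covDivT η (unitsField (toUField U)) b.dir b.src))).re) / (Fintype.card (Fin N) : ℝ))) 0 := by
  have hγ : ∀ b, HasDerivAt (fun t : ℝ => ((expChart U (t • X) b : SU N) : Matrix (Fin N) (Fin N) ℂ))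
      ((U b : Matrix (Fin N) (Fin N) ℂ) * (X b : Matrix (Fin N) (Fin N) ℂ)) 0 :=
    hasDerivAt_coe_expChart_along (U := U) (c := fun t : ℝ => t • X) (hasDerivAt_ray X) (zero_smul ℝ X)
  have h := hasDerivAt_wilsonAction4_covDivT hγ hη
  simp only [zero_smul, expChart_zero] at h
  exact h

end Main

end Literature.MathematicalPhysics.QuantumFieldTheory.Balaban1983to89.Node00

end
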